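import Literature.Analysis.Fourier.FejerRieszFactorization

/-!
# Boas–Kac factorisation: the objects of the discretisation (definitions only)

The Boas–Kac factorisation (`BoasKacFourierSide.lean`, `BoasKacSmooth.lean`: finite sums of autocorrelations
`gᵢ ⋆ g̃ᵢ` of functions supported in an interval are single autocorrelations `f ⋆ f̃`) is proved by
discretisation on the lattice `hℤ`, the Fejér–Riesz theorem, and a weak limit.  This file only NAMES the
objects, so that the theorem files downstream are pure proof files:

* `LatticeStep.latticeStep h Q` — the step function with value `Q_k` on the cell `[kh, (k+1)h)` (zero left of
  `0`); `LatticeStep.cellChar h ξ = ∫₀ʰ e^{-2πiyξ} dy`, `LatticeStep.latticePoint h ξ = e^{-2πihξ}`;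
  `LatticeStep.samplePoly h n g = Σ_{k ≤ n} g(kh) X^k` (a polynomial as a container of samples);
* `BoasKac.mesh L N = L/(N+1)`, the sampling polynomials `BoasKac.samplePolys`, a Fejér–Riesz factor
  `BoasKac.frFactor` of `Σᵢ Pᵢ · conjReverse Pᵢ` (chosen by `Classical.choose` from the sum form of the
  Fejér–Riesz theorem), the approximants `BoasKac.approx L g N = latticeStep h_N (frFactor …)` and the sampled
  step functions `BoasKac.sampleStep`.

All analytic facts about them are in `LatticeStepFourier.lean` / `BoasKacFourierSide.lean`. [cite: BoasKac1945, Thm 1]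
-/

noncomputable section

open Polynomial MeasureTheory Filter
open _root_.Complex _root_.Real
open scoped ComplexConjugate Topology

namespace Literature.Analysis.Fourier.LatticeStep

/-- The lattice step function of mesh `h` with cell values the coefficients of `Q`:
`Q_{⌊x/h⌋}` on `x ≥ 0`, zero on `x < 0` (and zero beyond `(natDegree Q + 1) h`). [folklore] -/
def latticeStep (h : ℝ) (Q : ℂ[X]) : ℝ → ℂ := fun x => if 0 ≤ x then Q.coeff ⌊x / h⌋₊ else 0

/-- The cell character integral `∫₀ʰ e^{-2πiyξ} dy`. [folklore] -/
def cellChar (h ξ : ℝ) : ℂ := ∫ y in (0 : ℝ)..h, cexp (↑(2 * π * (-(y * ξ))) * I)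

/-- The lattice point on the unit circle `z = e^{-2πihξ}`. [folklore] -/
def latticePoint (h ξ : ℝ) : ℂ := cexp (↑(2 * π * (-(h * ξ))) * I)

/-- `|e^{-2πihξ}| = 1`. [folklore] -/
theorem norm_latticePoint (h ξ : ℝ) : ‖latticePoint h ξ‖ = 1 := norm_exp_ofReal_mul_I _

/-- The sampling polynomial `Σ_{k ≤ n} g(kh) X^k`. [folklore] -/
def samplePoly (h : ℝ) (n : ℕ) (g : ℝ → ℂ) : ℂ[X] := ∑ k ∈ Finset.range (n + 1), C (g (k * h)) * X ^ k

/-- `natDegree (samplePoly h n g) ≤ n`. [folklore] -/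
theorem natDegree_samplePoly_le (h : ℝ) (n : ℕ) (g : ℝ → ℂ) : (samplePoly h n g).natDegree ≤ n := by
  unfold samplePoly
  exact natDegree_sum_le_of_forall_le _ _ fun k hk =>
    (natDegree_C_mul_X_pow_le _ _).trans (Nat.lt_succ_iff.mp (Finset.mem_range.mp hk))

end Literature.Analysis.Fourier.LatticeStep

namespace Literature.Analysis.Fourier.BoasKac

open Literature.Analysis.Fourier.FejerRiesz Literature.Analysis.Fourier.LatticeStep

section Setup

variable {ι : Type*} [Fintype ι] {L : ℝ}

/-- Mesh of the `N`-th discretisation: `h_N = L/(N+1)`. [folklore] -/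
def mesh (L : ℝ) (N : ℕ) : ℝ := L / ((N : ℝ) + 1)

/-- `0 < h_N`. [folklore] -/
theorem mesh_pos (hL : 0 < L) (N : ℕ) : 0 < mesh L N := by unfold mesh; positivity

/-- `h_N ≤ L`. [folklore] -/
theorem mesh_le (hL : 0 < L) (N : ℕ) : mesh L N ≤ L := by
  unfold mesh; rw [div_le_iff₀ (by positivity)]; nlinarith [(Nat.cast_nonneg N : (0 : ℝ) ≤ N)]

/-- `(n+1) h = L + h` for `n = N + 1` cells: the lattice overshoots `[0, L]` by one cell. [folklore] -/
theorem cells_mul_mesh (hL : 0 < L) (N : ℕ) : (((N + 1 : ℕ) : ℝ) + 1) * mesh L N = L + mesh L N := by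
  unfold mesh; push_cast; field_simp

/-- `L < (n+1) h` for `n = N + 1`. [folklore] -/
theorem lt_cells_mul_mesh (hL : 0 < L) (N : ℕ) : L < (((N + 1 : ℕ) : ℝ) + 1) * mesh L N := by
  rw [cells_mul_mesh hL N]; linarith [mesh_pos hL N]

/-- `h_N → 0`. [folklore] -/
theorem tendsto_mesh (L : ℝ) : Tendsto (mesh L) atTop (𝓝 0) := by
  have h := (tendsto_one_div_add_atTop_nhds_zero_nat).const_mul L
  rw [mul_zero] at h
  refine h.congr fun N => ?_
  unfold mesh; ring

variable (L) in
/-- The sampling polynomials `Pᵢ = Σ_{k ≤ N+1} gᵢ(k h_N) X^k`. [folklore] -/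
def samplePolys (g : ι → ℝ → ℂ) (N : ℕ) (i : ι) : ℂ[X] := samplePoly (mesh L N) (N + 1) (g i)

variable (L) in
/-- A Fejér–Riesz factor of `Σᵢ Pᵢ · conjReverse Pᵢ` (sum form of the Fejér–Riesz theorem). [folklore] -/
def frFactor (g : ι → ℝ → ℂ) (N : ℕ) : ℂ[X] :=
  Classical.choose (exists_eq_mul_conjReverse_of_sum Finset.univ (samplePolys L g N) (N + 1)
    fun _ _ => natDegree_samplePoly_le _ _ _)

variable (L) in
/-- `natDegree (frFactor L g N) ≤ N + 1`. [folklore] -/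
theorem natDegree_frFactor_le (g : ι → ℝ → ℂ) (N : ℕ) : (frFactor L g N).natDegree ≤ N + 1 :=
  (Classical.choose_spec (exists_eq_mul_conjReverse_of_sum Finset.univ (samplePolys L g N) (N + 1)
    fun _ _ => natDegree_samplePoly_le _ _ _)).1

variable (L) in
/-- The defining property of the Fejér–Riesz factor: `Σᵢ Pᵢ · conjReverse Pᵢ = Q · conjReverse Q`.
[cite: Fejer1916, §1] -/
theorem frFactor_spec (g : ι → ℝ → ℂ) (N : ℕ) :
    ∑ i, samplePolys L g N i * conjReverse (N + 1) (samplePolys L g N i) =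
      frFactor L g N * conjReverse (N + 1) (frFactor L g N) :=
  (Classical.choose_spec (exists_eq_mul_conjReverse_of_sum Finset.univ (samplePolys L g N) (N + 1)
    fun _ _ => natDegree_samplePoly_le _ _ _)).2

variable (L) in
/-- The `N`-th approximant `f_N`: lattice step function of the Fejér–Riesz factor. [folklore] -/
def approx (g : ι → ℝ → ℂ) (N : ℕ) : ℝ → ℂ := latticeStep (mesh L N) (frFactor L g N)

variable (L) in
/-- The lattice step functions `Sᵢ` of the samples of `gᵢ`. [folklore] -/
def sampleStep (g : ι → ℝ → ℂ) (N : ℕ) (i : ι) : ℝ → ℂ := latticeStep (mesh L N) (samplePolys L g N i)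

end Setup

end Literature.Analysis.Fourier.BoasKac

end
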